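import Summits.AtomisticToContinuum.FouriersLaw.Theorems.ClosedConeSensitivity.Negative.ZeroFrictionDictionary
import Summits.AtomisticToContinuum.FouriersLaw.Theorems.JunctionLocalitySuperadditiveResistanceDeviceLiouville
import Literature.MathematicalPhysics.KineticTheory.LangevinChainFlowBounds
import Literature.Analysis.ODE.FlowDomain

/-!
# `CorrectorTheory` (stmt-AtomisticToContinuum-14071), part 7a: calculus of the closed Hamiltonian flow

Helper file for support item `stmt-AtomisticToContinuum-14071`
(`OddSectorIrreversibility.CorrectorTheory`, conjunct A (7): the leak identity is stated against
the CLOSED flow `Φ_t = detFlow`, i.e. the zero-friction kernels).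

For the isolated pinned chain `P₀ = pinnedChain ω₂ lam β 0` (`ω₂ > 0`, `lam, β ≥ 0`), `N` sites,
Hamiltonian vector field `Y = X_H` (`= P₀.drift N = hamField`), and the deterministic flow
`Φ_t x = detFlow ω₂ lam β N t x` of `ZeroFrictionDictionary.lean`:

* `detFlow_eq_add_integral`, `hasDerivWithinAt_detFlow`, `hasDerivAt_detFlow` — `Φ` solves
  `ż = Y(z)` (`t ≥ 0`); `detFlow_add` — the flow property `Φ_{s+t} = Φ_t ∘ Φ_s`;
* `detFlow_reversal` — TIME REVERSAL `Φ_t(Θ(Φ_t x)) = Θ x`, `Θ(q,p) = (q,-p)` (`Y ∘ Θ = -Θ ∘ Y`);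
* `contDiff_detFlow` — **`x ↦ Φ_t x` is `C^∞`**: the two-sided family
  `t ↦ Φ_t x` (`t ≥ 0`), `t ↦ Θ Φ_{-t} Θ x` (`t ≤ 0`) is a family of integral curves of the smooth
  field `Y` on `ℝ`, hence jointly smooth by Lang's Thm. IV.1.16 (PROVED in the tree,
  `Literature.Analysis.ODE.contDiffOn_flow_of_hasDerivAt`);
* `fderiv_detFlow_hamField` — `DΦ_t(x)·Y(x) = Y(Φ_t x)`; `liouvilleOp_comp_detFlow` —
  `X_H (f ∘ Φ_t) = (X_H f) ∘ Φ_t`; `comp_detFlow_sub_eq_integral` —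
  `f(Φ_t x) - f(x) = ∫₀ᵗ (X_H f)(Φ_s x) ds` for `f ∈ C¹`.

References: V. I. Arnold, Mathematical Methods of Classical Mechanics, §§1, 38; S. Lang,
Differential and Riemannian Manifolds (1995), Ch. IV §1. Nothing here closes the item.
-/

noncomputable section

open MeasureTheory Filter Topology Set Function
open scoped ContDiff NNReal
open Literature.MathematicalPhysics.KineticTheory.HeatConduction
open Literature.MathematicalPhysics.KineticTheory
open Summit.AtomisticToContinuum.FouriersLaw.Theorems.SuperadditiveResistance.DeviceLiouville
open Summit.AtomisticToContinuum.FouriersLaw.Theorems.ClosedConeSensitivity.Negative.ZeroFrictionDictionary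

namespace Summit.AtomisticToContinuum.FouriersLaw.Theorems.OddSectorIrreversibility.Corrector

variable {N : ℕ}

/-- At zero friction the Langevin drift is the Hamiltonian vector field. [folklore] -/
theorem drift_zero_friction (ω₂ lam β : ℝ) (N : ℕ) :
    (pinnedChain ω₂ lam β 0).drift N = hamField (pinnedChain ω₂ lam β 0) N := by
  have hU : Differentiable ℝ (pinnedChain ω₂ lam β 0).U :=
    (pinnedChain_contDiff_U ω₂ lam β 0 (n := 1)).differentiable one_ne_zero
  have hV : Differentiable ℝ (pinnedChain ω₂ lam β 0).V :=
    (pinnedChain_contDiff_V ω₂ lam β 0 (n := 1)).differentiable one_ne_zero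
  rw [(pinnedChain ω₂ lam β 0).drift_eq hU hV]
  funext x
  have hγ : (pinnedChain ω₂ lam β 0).γ = 0 := rfl
  simp only [hamField, hγ, zero_mul, sub_zero]

/-- `Y ∘ Θ = -Θ ∘ Y` for the Hamiltonian field (`H` is even in `p`). [folklore] -/
theorem hamField_flip (P : OscillatorChain) (N : ℕ) (z : PhaseSpace N) :
    hamField P N (z.1, -z.2) = ((-(hamField P N z).1, (hamField P N z).2) : PhaseSpace N) := by
  simp [hamField]

section Pinned

variable {ω₂ lam β : ℝ} (hω : 0 < ω₂) (hl : 0 ≤ lam) (hβ : 0 ≤ β)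
include hω hl hβ

/-- **The closed flow solves the integral equation** `Φ_t x = x + ∫₀ᵗ Y(Φ_s x) ds` (`t ≥ 0`).
[folklore] -/
theorem detFlow_eq_add_integral (N : ℕ) (x : PhaseSpace N) {t : ℝ} (ht : 0 ≤ t) :
    detFlow ω₂ lam β N t x = x + ∫ s in (0 : ℝ)..t,
      (pinnedChain ω₂ lam β 0).drift N (detFlow ω₂ lam β N s x) := by
  have h := pinnedChain_chainFlow_sub_sub_eq_integral hω hl hβ le_rfl (N := N) x
    (η := fun _ _ => (0 : ℝ)) continuous_const (T := t) (t := t) ⟨ht, le_rfl⟩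
  unfold detFlow
  have h0 : (((0 : Fin N → ℝ), fun _ : Fin N => (0 : ℝ)) : PhaseSpace N) = 0 := by ext i <;> simp
  rw [h0, sub_zero, sub_eq_iff_eq_add'] at h
  exact h

/-- The closed flow is continuous in time. [folklore] -/
theorem continuous_detFlow_time (N : ℕ) (x : PhaseSpace N) : Continuous fun t => detFlow ω₂ lam β N t x :=
  pinnedChain_continuous_chainFlow hω hl hβ le_rfl N x continuous_const

/-- **`Φ` solves `ż = Y(z)`**: right derivative at every `t ≥ 0`. [folklore] -/
theorem hasDerivWithinAt_detFlow (N : ℕ) (x : PhaseSpace N) {t : ℝ} (ht : 0 ≤ t) :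
    HasDerivWithinAt (fun s => detFlow ω₂ lam β N s x)
      ((pinnedChain ω₂ lam β 0).drift N (detFlow ω₂ lam β N t x)) (Ici t) t := by
  set Y := (pinnedChain ω₂ lam β 0).drift N with hY
  have hYc : Continuous Y := (pinnedChain_contDiff_drift ω₂ lam β 0 N (n := 0)).continuous
  have hc : Continuous fun s => Y (detFlow ω₂ lam β N s x) := hYc.comp (continuous_detFlow_time hω hl hβ N x)
  have hF : HasDerivAt (fun s => x + ∫ r in (0 : ℝ)..s, Y (detFlow ω₂ lam β N r x))
      (Y (detFlow ω₂ lam β N t x)) t :=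
    (intervalIntegral.integral_hasDerivAt_right (hc.intervalIntegrable _ _)
      hc.aestronglyMeasurable.stronglyMeasurableAtFilter hc.continuousAt).const_add x
  refine (hF.hasDerivWithinAt (s := Ici t)).congr (fun s hs => ?_) ?_
  · exact detFlow_eq_add_integral hω hl hβ N x (ht.trans hs)
  · exact detFlow_eq_add_integral hω hl hβ N x ht

/-- Two-sided derivative at `t > 0`. [folklore] -/
theorem hasDerivAt_detFlow (N : ℕ) (x : PhaseSpace N) {t : ℝ} (ht : 0 < t) :
    HasDerivAt (fun s => detFlow ω₂ lam β N s x)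
      ((pinnedChain ω₂ lam β 0).drift N (detFlow ω₂ lam β N t x)) t := by
  set Y := (pinnedChain ω₂ lam β 0).drift N with hY
  have hYc : Continuous Y := (pinnedChain_contDiff_drift ω₂ lam β 0 N (n := 0)).continuous
  have hc : Continuous fun s => Y (detFlow ω₂ lam β N s x) := hYc.comp (continuous_detFlow_time hω hl hβ N x)
  have hF : HasDerivAt (fun s => x + ∫ r in (0 : ℝ)..s, Y (detFlow ω₂ lam β N r x))
      (Y (detFlow ω₂ lam β N t x)) t :=
    (intervalIntegral.integral_hasDerivAt_right (hc.intervalIntegrable _ _)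
      hc.aestronglyMeasurable.stronglyMeasurableAtFilter hc.continuousAt).const_add x
  refine hF.congr_of_eventuallyEq ?_
  filter_upwards [Ioi_mem_nhds ht] with s hs
  exact detFlow_eq_add_integral hω hl hβ N x (le_of_lt hs)

/-- **The flow property** `Φ_{s+t} x = Φ_t (Φ_s x)` (`s, t ≥ 0`; autonomous field, zero noise).
[folklore] -/
theorem detFlow_add (N : ℕ) (x : PhaseSpace N) {s t : ℝ} (hs : 0 ≤ s) (ht : 0 ≤ t) :
    detFlow ω₂ lam β N (s + t) x = detFlow ω₂ lam β N t (detFlow ω₂ lam β N s x) := by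
  unfold detFlow
  rw [pinnedChain_chainFlow_add hω hl hβ le_rfl N x continuous_const hs ht]
  simp only [sub_self]
  rfl

/-- **Time reversal of the Hamiltonian flow**: `Φ_t (Θ (Φ_t x)) = Θ x` with `Θ(q,p) = (q,-p)`
(`t ≥ 0`): the reversed-and-flipped trajectory `s ↦ Θ Φ_{t-s} x` solves the same equation
(`Y(Θ z) = -Θ Y(z)`), so it is the flow issued from `Θ Φ_t x`. [cite: Arnold1989, §8 (reversibility)] -/
theorem detFlow_reversal (N : ℕ) (x : PhaseSpace N) {t : ℝ} (ht : 0 ≤ t) :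
    detFlow ω₂ lam β N t ((detFlow ω₂ lam β N t x).1, -(detFlow ω₂ lam β N t x).2) =
      ((x.1, -x.2) : PhaseSpace N) := by
  set P₀ := pinnedChain ω₂ lam β 0 with hP₀
  set Y := P₀.drift N with hY
  set Φ := fun s y => detFlow ω₂ lam β N s y with hΦ
  set Θ : PhaseSpace N →L[ℝ] PhaseSpace N :=
    (ContinuousLinearMap.fst ℝ (Fin N → ℝ) (Fin N → ℝ)).prod
      (-(ContinuousLinearMap.snd ℝ (Fin N → ℝ) (Fin N → ℝ))) with hΘ
  have hΘa : ∀ y : PhaseSpace N, Θ y = (y.1, -y.2) := fun y => rfl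
  have hΘΘ : ∀ y : PhaseSpace N, Θ (Θ y) = y := fun y => by rw [hΘa, hΘa]; simp
  have hYΘ : ∀ z, Y (Θ z) = -Θ (Y z) := fun z => by
    rw [hY, drift_zero_friction, hΘa, hamField_flip, hΘa]
    ext i <;> simp
  have hYc : Continuous Y := (pinnedChain_contDiff_drift ω₂ lam β 0 N (n := 0)).continuous
  -- the reversed-and-flipped trajectory
  set y : PhaseSpace N := Θ (Φ t x) with hy
  set w : ℝ → PhaseSpace N := fun s => Θ (Φ (t - s) x) with hw
  have hwc : Continuous w := Θ.continuous.comp ((continuous_detFlow_time hω hl hβ N x).comp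
    (continuous_const.sub continuous_id))
  have hflow : ∀ r, 0 ≤ r → Φ r x = x + ∫ u in (0 : ℝ)..r, Y (Φ u x) := fun r hr =>
    detFlow_eq_add_integral hω hl hβ N x hr
  have hYΦc : Continuous fun u => Y (Φ u x) := hYc.comp (continuous_detFlow_time hω hl hβ N x)
  have hsol : Literature.Analysis.ODE.IsIntegralSolutionOn Y (OscillatorChain.forcing y fun _ _ => (0 : ℝ)) w t := by
    intro s hs
    have hts : 0 ≤ t - s := by linarith [hs.2]
    have h0 : (((0 : Fin N → ℝ), fun _ : Fin N => (0 : ℝ)) : PhaseSpace N) = 0 := by ext i <;> simp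
    simp only [OscillatorChain.forcing, h0, add_zero]
    -- `w s - w 0 = Θ (Φ_{t-s} x - Φ_t x) = -Θ ∫_{t-s}^t Y(Φ_u x) du = ∫₀ˢ Y(w r) dr`
    have h1 : Φ (t - s) x - Φ t x = -∫ u in (t - s)..t, Y (Φ u x) := by
      rw [hflow _ hts, hflow _ ht, add_sub_add_left_eq_sub,
        ← intervalIntegral.integral_add_adjacent_intervals (hYΦc.intervalIntegrable 0 (t - s))
          (hYΦc.intervalIntegrable (t - s) t)]
      abel
    have h2 : ∫ r in (0 : ℝ)..s, Y (w r) = -Θ (∫ u in (t - s)..t, Y (Φ u x)) := by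
      have e1 : (fun r => Y (w r)) = fun r => -Θ (Y (Φ (t - r) x)) := by
        funext r; rw [hw]; exact hYΘ _
      have hint : IntervalIntegrable (fun r => Y (Φ (t - r) x)) volume 0 s :=
        (hYΦc.comp (continuous_const.sub continuous_id)).intervalIntegrable _ _
      have h2a : ∫ r in (0 : ℝ)..s, Θ (Y (Φ (t - r) x)) = Θ (∫ r in (0 : ℝ)..s, Y (Φ (t - r) x)) :=
        Θ.intervalIntegral_comp_comm hint
      have h2b : ∫ r in (0 : ℝ)..s, Y (Φ (t - r) x) = ∫ u in (t - s)..t, Y (Φ u x) := by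
        rw [intervalIntegral.integral_comp_sub_left (fun u => Y (Φ u x)) t, sub_zero]
      rw [e1, intervalIntegral.integral_neg, h2a, h2b]
    rw [h2, hw, hy]
    simp only
    rw [← map_neg, ← map_add]
    congr 1
    exact sub_eq_iff_eq_add'.1 h1
  have heq := pinnedChain_eqOn_chainFlow hω hl hβ le_rfl N y continuous_const hsol hwc ⟨ht, le_rfl⟩
  -- `w t = Θ x` is `Φ_t y`
  have hwt : w t = Θ x := by
    rw [hw]
    simp only [sub_self]
    rw [show Φ 0 x = x from detFlow_of_nonpos (ω₂ := ω₂) (lam := lam) (β := β) N le_rfl x]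
  rw [← hΘa, ← hΘa x, ← hwt, heq]
  rfl


/-- **The closed flow is smooth in the initial condition.** For `t ≥ 0`, `x ↦ Φ_t x` is `C^∞`:
the two-sided family `s ↦ Φ_s x` (`s ≥ 0`), `s ↦ Θ Φ_{-s} Θ x` (`s ≤ 0`) consists of integral
curves of the smooth field `Y` (time reversal), so Lang's theorem on the smoothness of flows on
their domain applies. [cite: Lang1995, Ch. IV §1, Thm. 1.16] -/
theorem contDiff_detFlow (N : ℕ) {t : ℝ} (ht : 0 ≤ t) : ContDiff ℝ ∞ (detFlow ω₂ lam β N t) := by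
  set P₀ := pinnedChain ω₂ lam β 0 with hP₀
  set Y := P₀.drift N with hY
  set Φ := fun s y => detFlow ω₂ lam β N s y with hΦ
  set Θ : PhaseSpace N →L[ℝ] PhaseSpace N :=
    (ContinuousLinearMap.fst ℝ (Fin N → ℝ) (Fin N → ℝ)).prod
      (-(ContinuousLinearMap.snd ℝ (Fin N → ℝ) (Fin N → ℝ))) with hΘ
  have hΘa : ∀ y : PhaseSpace N, Θ y = (y.1, -y.2) := fun y => rfl
  have hΘΘ : ∀ y : PhaseSpace N, Θ (Θ y) = y := fun y => by rw [hΘa, hΘa]; simp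
  have hYΘ : ∀ z, Y (Θ z) = -Θ (Y z) := fun z => by
    rw [hY, drift_zero_friction, hΘa, hamField_flip, hΘa]
    ext i <;> simp
  have hYs : ContDiff ℝ ∞ Y := pinnedChain_contDiff_drift ω₂ lam β 0 N
  have hΦ0 : ∀ y, Φ 0 y = y := fun y => detFlow_of_nonpos (ω₂ := ω₂) (lam := lam) (β := β) N le_rfl y
  -- the two-sided family of integral curves
  set Ψ : PhaseSpace N → ℝ → PhaseSpace N := fun x s => if 0 ≤ s then Φ s x else Θ (Φ (-s) (Θ x)) with hΨ
  have hΨpos : ∀ x {s : ℝ}, 0 ≤ s → Ψ x s = Φ s x := fun x s hs => by simp only [hΨ, if_pos hs]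
  have hΨneg : ∀ x {s : ℝ}, s ≤ 0 → Ψ x s = Θ (Φ (-s) (Θ x)) := fun x s hs => by
    rcases hs.eq_or_lt with h | h
    · subst h; simp only [hΨ, le_refl, if_true, neg_zero, hΦ0, hΘΘ]
    · simp only [hΨ, if_neg (not_le.2 h)]
  have h0 : ∀ x ∈ (univ : Set (PhaseSpace N)), Ψ x 0 = x := fun x _ => by rw [hΨpos x le_rfl, hΦ0]
  have hd : ∀ x ∈ (univ : Set (PhaseSpace N)), ∀ s ∈ Ioo (-(t + 1)) (t + 1), HasDerivAt (Ψ x) (Y (Ψ x s)) s := by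
    intro x _ s _
    rcases lt_trichotomy s 0 with hs | hs | hs
    · -- `s < 0`: the flipped reversed flow
      have hg : HasDerivAt (fun r => Φ r (Θ x)) (Y (Φ (-s) (Θ x))) (-s) :=
        hasDerivAt_detFlow hω hl hβ N (Θ x) (by linarith)
      have hcomp : HasDerivAt (fun r => Φ (-r) (Θ x)) ((-1 : ℝ) • Y (Φ (-s) (Θ x))) s := by
        have := hg.scomp s (hasDerivAt_neg s)
        exact this
      have hΘd := Θ.hasFDerivAt.comp_hasDerivAt s hcomp
      have hval : Θ ((-1 : ℝ) • Y (Φ (-s) (Θ x))) = Y (Ψ x s) := by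
        rw [hΨneg x hs.le, hYΘ, map_smul]; simp
      rw [hval] at hΘd
      refine hΘd.congr_of_eventuallyEq ?_
      filter_upwards [Iio_mem_nhds hs] with r hr
      exact hΨneg x (le_of_lt hr)
    · -- `s = 0`: glue the one-sided derivatives
      subst hs
      have hR : HasDerivWithinAt (Ψ x) (Y x) (Ici 0) 0 := by
        have h := hasDerivWithinAt_detFlow hω hl hβ N x le_rfl
        rw [show detFlow ω₂ lam β N 0 x = x from hΦ0 x] at h
        exact h.congr (fun r hr => hΨpos x hr) (by rw [hΨpos x le_rfl])
      have hL : HasDerivWithinAt (Ψ x) (Y x) (Iic 0) 0 := by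
        have hg : HasDerivWithinAt (fun r => Φ r (Θ x)) (Y (Φ 0 (Θ x))) (Ici 0) 0 :=
          hasDerivWithinAt_detFlow hω hl hβ N (Θ x) le_rfl
        have hneg : HasDerivWithinAt (fun r : ℝ => -r) (-1 : ℝ) (Iic 0) 0 := (hasDerivWithinAt_neg 0 _)
        have hmaps : MapsTo (fun r : ℝ => -r) (Iic (0 : ℝ)) (Ici 0) := fun r hr => by
          simp only [mem_Iic] at hr; simp only [mem_Ici]; linarith
        have hcomp : HasDerivWithinAt (fun r => Φ (-r) (Θ x)) ((-1 : ℝ) • Y (Φ 0 (Θ x))) (Iic 0) 0 :=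
          hg.scomp_of_eq (0 : ℝ) hneg hmaps (by simp)
        have hΘd := Θ.hasFDerivAt.comp_hasDerivWithinAt (0 : ℝ) hcomp
        have hval : Θ ((-1 : ℝ) • Y (Φ 0 (Θ x))) = Y x := by
          rw [hΦ0, hYΘ, map_smul]; simp [hΘΘ]
        rw [hval] at hΘd
        refine hΘd.congr (fun r hr => hΨneg x hr) ?_
        rw [hΨneg x le_rfl]
        rfl
      have hval0 : Ψ x 0 = x := h0 x (mem_univ x)
      have hu := hL.union hR
      rw [Iic_union_Ici, hasDerivWithinAt_univ] at hu
      rwa [hval0]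
    · -- `s > 0`: the forward flow
      refine (hasDerivAt_detFlow hω hl hβ N x hs).congr_of_eventuallyEq ?_ |>.congr_deriv ?_
      · filter_upwards [Ioi_mem_nhds hs] with r hr
        exact hΨpos x (le_of_lt hr)
      · rw [hΨpos x hs.le]
  have hUm : ∀ x ∈ (univ : Set (PhaseSpace N)), ∀ s ∈ Ioo (-(t + 1)) (t + 1), Ψ x s ∈ (univ : Set (PhaseSpace N)) :=
    fun _ _ _ _ => mem_univ _
  have hLang := Literature.Analysis.ODE.contDiffOn_flow_of_hasDerivAt (n := (⊤ : ℕ∞)) isOpen_univ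
    hYs.contDiffOn (by exact_mod_cast le_top) isOpen_univ h0 hd hUm
  -- restrict to the slice `s = t`
  have hmem : ∀ x : PhaseSpace N, (x, t) ∈ (univ : Set (PhaseSpace N)) ×ˢ Ioo (-(t + 1)) (t + 1) :=
    fun x => ⟨mem_univ _, by constructor <;> linarith⟩
  have hcomp : ContDiff ℝ ∞ (fun x : PhaseSpace N => Ψ x t) :=
    hLang.comp_contDiff (contDiff_id.prodMk contDiff_const) hmem
  have heq : (fun x : PhaseSpace N => Ψ x t) = detFlow ω₂ lam β N t := by
    funext x; rw [hΨpos x ht]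
  rw [heq] at hcomp
  exact hcomp

/-- **The flow transports its own generator**: `DΦ_t(x)·Y(x) = Y(Φ_t x)` (`t ≥ 0`), from the
flow property differentiated at `r = 0⁺`. [folklore] -/
theorem fderiv_detFlow_drift (N : ℕ) {t : ℝ} (ht : 0 ≤ t) (x : PhaseSpace N) :
    fderiv ℝ (detFlow ω₂ lam β N t) x ((pinnedChain ω₂ lam β 0).drift N x) =
      (pinnedChain ω₂ lam β 0).drift N (detFlow ω₂ lam β N t x) := by
  set Y := (pinnedChain ω₂ lam β 0).drift N with hY
  have h0 : detFlow ω₂ lam β N 0 x = x := detFlow_of_nonpos (ω₂ := ω₂) (lam := lam) (β := β) N le_rfl x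
  have hdiff : DifferentiableAt ℝ (detFlow ω₂ lam β N t) x :=
    ((contDiff_detFlow hω hl hβ N ht).differentiable (by simp)) x
  -- derivative of `r ↦ Φ_t (Φ_r x)` at `0⁺`
  have h1 : HasDerivWithinAt (fun r => detFlow ω₂ lam β N t (detFlow ω₂ lam β N r x))
      (fderiv ℝ (detFlow ω₂ lam β N t) x (Y x)) (Ici 0) 0 := by
    have hin := hasDerivWithinAt_detFlow hω hl hβ N x le_rfl
    rw [h0] at hin
    have hF : HasFDerivAt (detFlow ω₂ lam β N t) (fderiv ℝ (detFlow ω₂ lam β N t) x)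
        (detFlow ω₂ lam β N 0 x) := by rw [h0]; exact hdiff.hasFDerivAt
    exact hF.comp_hasDerivWithinAt (0 : ℝ) hin
  -- derivative of `r ↦ Φ_{r+t} x` at `0⁺`
  have h2 : HasDerivWithinAt (fun r => detFlow ω₂ lam β N (r + t) x) (Y (detFlow ω₂ lam β N t x)) (Ici 0) 0 := by
    have hg := hasDerivWithinAt_detFlow hω hl hβ N x ht
    have hadd : HasDerivWithinAt (fun r : ℝ => r + t) (1 : ℝ) (Ici 0) 0 := (hasDerivWithinAt_id _ _).add_const t
    have hmaps : MapsTo (fun r : ℝ => r + t) (Ici (0 : ℝ)) (Ici t) := fun r hr => by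
      simp only [mem_Ici] at hr ⊢; linarith
    have h := hg.scomp_of_eq (0 : ℝ) hadd hmaps (by simp)
    rw [one_smul] at h
    exact h
  have h2' : HasDerivWithinAt (fun r => detFlow ω₂ lam β N t (detFlow ω₂ lam β N r x))
      (Y (detFlow ω₂ lam β N t x)) (Ici 0) 0 :=
    h2.congr (fun r hr => (detFlow_add hω hl hβ N x hr ht).symm) (by rw [zero_add, h0])
  exact (uniqueDiffWithinAt_Ici 0).eq_deriv _ h1 h2'

omit hω hl hβ in
/-- The Hamiltonian vector field does not depend on the friction constant. [folklore] -/
theorem hamField_indep_friction (γ : ℝ) (N : ℕ) :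
    hamField (pinnedChain ω₂ lam β γ) N = (pinnedChain ω₂ lam β 0).drift N := by
  rw [drift_zero_friction]; rfl

/-- **`X_H (f ∘ Φ_t) = (X_H f) ∘ Φ_t`** for `f ∈ C¹`, `t ≥ 0` (the Liouville operator of the
chain with any friction `γ`; it only involves `H`). [folklore] -/
theorem liouvilleOp_comp_detFlow (γ : ℝ) (N : ℕ) {f : PhaseSpace N → ℝ} (hf : ContDiff ℝ 1 f) {t : ℝ}
    (ht : 0 ≤ t) (x : PhaseSpace N) :
    liouvilleOp (pinnedChain ω₂ lam β γ) N (fun y => f (detFlow ω₂ lam β N t y)) x =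
      liouvilleOp (pinnedChain ω₂ lam β γ) N f (detFlow ω₂ lam β N t x) := by
  set P := pinnedChain ω₂ lam β γ with hP
  have hU : Differentiable ℝ P.U := (pinnedChain_contDiff_U ω₂ lam β γ (n := 1)).differentiable one_ne_zero
  have hV : Differentiable ℝ P.V := (pinnedChain_contDiff_V ω₂ lam β γ (n := 1)).differentiable one_ne_zero
  have hfd : Differentiable ℝ f := hf.differentiable one_ne_zero
  have hΦd : Differentiable ℝ (detFlow ω₂ lam β N t) := (contDiff_detFlow hω hl hβ N ht).differentiable (by simp)
  have hcd : Differentiable ℝ fun y => f (detFlow ω₂ lam β N t y) := hfd.comp hΦd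
  rw [liouvilleOp_eq_fderiv P hU hV hcd, liouvilleOp_eq_fderiv P hU hV hfd,
    hamField_indep_friction (ω₂ := ω₂) (lam := lam) (β := β)]
  change (fderiv ℝ (f ∘ detFlow ω₂ lam β N t) x) _ = _
  rw [fderiv_comp x (hfd _) (hΦd x)]
  simp only [ContinuousLinearMap.coe_comp, Function.comp_apply]
  rw [fderiv_detFlow_drift hω hl hβ N ht x]

/-- `s ↦ f (Φ_s x)` has right derivative `(X_H f)(Φ_s x)` (`f ∈ C¹`, `s ≥ 0`). [folklore] -/
theorem hasDerivWithinAt_comp_detFlow (γ : ℝ) (N : ℕ) {f : PhaseSpace N → ℝ} (hf : ContDiff ℝ 1 f)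
    (x : PhaseSpace N) {s : ℝ} (hs : 0 ≤ s) :
    HasDerivWithinAt (fun r => f (detFlow ω₂ lam β N r x))
      (liouvilleOp (pinnedChain ω₂ lam β γ) N f (detFlow ω₂ lam β N s x)) (Ici s) s := by
  set P := pinnedChain ω₂ lam β γ with hP
  have hU : Differentiable ℝ P.U := (pinnedChain_contDiff_U ω₂ lam β γ (n := 1)).differentiable one_ne_zero
  have hV : Differentiable ℝ P.V := (pinnedChain_contDiff_V ω₂ lam β γ (n := 1)).differentiable one_ne_zero
  have hfd : Differentiable ℝ f := hf.differentiable one_ne_zero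
  have h := (hfd (detFlow ω₂ lam β N s x)).hasFDerivAt.comp_hasDerivWithinAt s
    (hasDerivWithinAt_detFlow hω hl hβ N x hs)
  rw [liouvilleOp_eq_fderiv P hU hV hfd, hamField_indep_friction (ω₂ := ω₂) (lam := lam) (β := β)]
  exact h

/-- **Transport along the closed flow**: `f(Φ_t x) - f(x) = ∫₀ᵗ (X_H f)(Φ_s x) ds` for `f ∈ C¹`,
`t ≥ 0`. [folklore] -/
theorem comp_detFlow_sub_eq_integral (γ : ℝ) (N : ℕ) {f : PhaseSpace N → ℝ} (hf : ContDiff ℝ 1 f)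
    {t : ℝ} (ht : 0 ≤ t) (x : PhaseSpace N) :
    f (detFlow ω₂ lam β N t x) - f x =
      ∫ s in (0 : ℝ)..t, liouvilleOp (pinnedChain ω₂ lam β γ) N f (detFlow ω₂ lam β N s x) := by
  set P := pinnedChain ω₂ lam β γ with hP
  have hU : Differentiable ℝ P.U := (pinnedChain_contDiff_U ω₂ lam β γ (n := 1)).differentiable one_ne_zero
  have hV : Differentiable ℝ P.V := (pinnedChain_contDiff_V ω₂ lam β γ (n := 1)).differentiable one_ne_zero
  have hfd : Differentiable ℝ f := hf.differentiable one_ne_zero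
  have hΦc : Continuous fun s => detFlow ω₂ lam β N s x := continuous_detFlow_time hω hl hβ N x
  have hgc : Continuous fun s => f (detFlow ω₂ lam β N s x) := hf.continuous.comp hΦc
  -- the integrand is continuous
  have hYc : Continuous ((pinnedChain ω₂ lam β 0).drift N) := (pinnedChain_contDiff_drift ω₂ lam β 0 N (n := 0)).continuous
  have hic : Continuous fun s => liouvilleOp P N f (detFlow ω₂ lam β N s x) := by
    have e : (fun s => liouvilleOp P N f (detFlow ω₂ lam β N s x)) = fun s =>
        fderiv ℝ f (detFlow ω₂ lam β N s x) ((pinnedChain ω₂ lam β 0).drift N (detFlow ω₂ lam β N s x)) := by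
      funext s; rw [liouvilleOp_eq_fderiv P hU hV hfd, hamField_indep_friction (ω₂ := ω₂) (lam := lam) (β := β)]
    rw [e]
    exact ((hf.continuous_fderiv one_ne_zero).comp hΦc).clm_apply (hYc.comp hΦc)
  have h0 : detFlow ω₂ lam β N 0 x = x := detFlow_of_nonpos (ω₂ := ω₂) (lam := lam) (β := β) N le_rfl x
  have hFTC := intervalIntegral.integral_eq_sub_of_hasDeriv_right_of_le ht hgc.continuousOn
    (fun s hs => (hasDerivWithinAt_comp_detFlow hω hl hβ γ N hf x hs.1.le).mono Ioi_subset_Ici_self)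
    (hic.intervalIntegrable 0 t)
  rw [hFTC, h0]

end Pinned

end Summit.AtomisticToContinuum.FouriersLaw.Theorems.OddSectorIrreversibility.Corrector

end
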